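import Literature.Probability.Process.BrownianBridgeToPoint3
import Mathlib.Analysis.SpecialFunctions.Gamma.Basic
import Mathlib.Analysis.SpecialFunctions.Gaussian.GaussianIntegral
import Mathlib.MeasureTheory.Integral.IntegralEqImproper
import Mathlib.Geometry.Euclidean.Inversion.Basic
import HarnessLib

/-!
# The lifetime law of the Brownian bridge-to-a-point in `ℝ³`: normalisation (the Green identity
`∫₀^∞ p_t(x,y) dt = (2π‖x − y‖)⁻¹`) and Kelvin covariance under the unit inversion

Topic `Literature/Probability/Process`; everything here is PROVED (no named fact). It discharges
the normalisation caveat recorded in `BrownianBridgeToPoint3.lean` for the definitions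
`hittingTimeLaw` / `brownianBridgeToPointRangeLaw3` (requested for the support statement
`KelvinBridgeCovariance`, item `stmt-CriticalPhenomena-5033`, of the route
`Summit.CriticalPhenomena.Ising3DConformalLimit.Theses.MoebiusRestrictionCurrents`):

* `integral_rpow_neg_three_halves_mul_exp_neg_div` — `∫₀^∞ t^{-3/2} e^{-c/t} dt = c^{-1/2} Γ(1/2)
  = √(π)/√c` for `c > 0` (substitution `t ↦ 1/t`, then the Gamma integral);
* `integral_heatKernel3` — the Green (Newton) kernel of standard Brownian motion in `ℝ³`:
  `∫₀^∞ (2πt)^{-3/2} exp(−‖x − y‖²/2t) dt = (2π‖x − y‖)⁻¹` for `x ≠ y`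
  (Port–Stone 1978, Ch. 3; Le Gall 2016, §7);
* `integral_hittingDensity` — the lifetime density `2π‖x − y‖ · p_t(x, y)` integrates to `1`;
* `isProbabilityMeasure_hittingTimeLaw` — hence `hittingTimeLaw x y` is a probability measure for
  `x ≠ y` (and `hittingTimeLaw_self : hittingTimeLaw x x = 0`, the degenerate case);
* `BrownianBridgeToPoint3.heatKernel3_inversion`, `.integral_heatKernel3_inversion`,
  `.hittingDensity_inversion`, `.hittingTimeLaw_inversion` — under the unit inversion
  `ι z = z/‖z‖²` (`x, y ≠ 0`): `p_u(ιx, ιy) = (‖x‖‖y‖)³ p_{(‖x‖‖y‖)²u}(x, y)`,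
  `G(ιx, ιy) = ‖x‖‖y‖ G(x, y)` (the `Δ = 1/2` two-point Möbius covariance) and
  `hittingTimeLaw (ιx) (ιy) = (hittingTimeLaw x y).map (· / (‖x‖‖y‖)²)` — the lifetime of the
  bridge-to-a-point transforms by the deterministic factor `(‖x‖‖y‖)⁻²` (the `n = 0` shadow of the
  Kelvin covariance `KelvinBridgeCovariance` of the whole range law, which is NOT proved here).

## References

* S. C. Port, C. J. Stone, *Brownian Motion and Classical Potential Theory*, Academic Press 1978,
  Ch. 3 (the potential kernel of Brownian motion in `ℝ³`). [PortStone1978]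
* J.-F. Le Gall, *Brownian Motion, Martingales, and Stochastic Calculus*, GTM 274 (2016), Ch. 7.
  [Legall2016]
-/

noncomputable section

open MeasureTheory Set Real
open scoped NNReal ENNReal

namespace Literature.Probability.Process

/-- **`∫₀^∞ t^{-3/2} e^{-c/t} dt = c^{-1/2} Γ(1/2)`** for `c > 0`, written as
`(1/c)^{1/2} · √π`: substitute `t ↦ t⁻¹` (`integral_comp_rpow_Ioi` with exponent `-1`) and use
the Gamma integral `∫₀^∞ y^{a-1} e^{-cy} dy = (1/c)^a Γ(a)` with `a = 1/2`, `Γ(1/2) = √π`. [folklore] -/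
theorem integral_rpow_neg_three_halves_mul_exp_neg_div {c : ℝ} (hc : 0 < c) :
    ∫ t in Ioi (0 : ℝ), t ^ (-(3 : ℝ) / 2) * Real.exp (-c / t)
      = (1 / c) ^ ((1 : ℝ) / 2) * Real.sqrt π := by
  have key := integral_comp_rpow_Ioi
    (fun y : ℝ => y ^ ((1 : ℝ) / 2 - 1) * Real.exp (-(c * y))) (p := (-1 : ℝ)) (by norm_num)
  have hG : ∫ y in Ioi (0 : ℝ), y ^ ((1 : ℝ) / 2 - 1) * Real.exp (-(c * y))
      = (1 / c) ^ ((1 : ℝ) / 2) * Real.Gamma (1 / 2) :=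
    integral_rpow_mul_exp_neg_mul_Ioi (by norm_num) hc
  rw [hG, Real.Gamma_one_half_eq] at key
  rw [← key]
  refine setIntegral_congr_fun measurableSet_Ioi fun t ht => ?_
  have ht' : 0 < t := ht
  rw [smul_eq_mul, ← Real.rpow_mul ht'.le, Real.rpow_neg_one, abs_neg, abs_one, one_mul,
    ← mul_assoc, ← Real.rpow_add ht']
  congr 1
  · norm_num
  · rw [neg_div, div_eq_mul_inv]

/-- **The Green identity for standard Brownian motion in `ℝ³`**: the time integral of the
transition density is the Newton kernel, `∫₀^∞ p_t(x, y) dt = (2π‖x − y‖)⁻¹` for `x ≠ y`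
(generator `½Δ`). [cite: PortStone1978, Ch. 3 (potential kernel of Brownian motion in ℝ³)] -/
theorem integral_heatKernel3 {x y : E3} (h : x ≠ y) :
    ∫ t in Ioi (0 : ℝ), heatKernel3 t x y = (2 * π * ‖x - y‖)⁻¹ := by
  have hr : 0 < ‖x - y‖ := norm_pos_iff.2 (sub_ne_zero.2 h)
  set r : ℝ := ‖x - y‖ with hrdef
  have hc : 0 < r ^ 2 / 2 := by positivity
  have h2π : (0 : ℝ) ≤ 2 * π := by positivity
  -- rewrite the integrand as `(2π)^{-3/2} · (t^{-3/2} e^{-c/t})` with `c = r²/2`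
  have hcongr : ∀ t ∈ Ioi (0 : ℝ), heatKernel3 t x y
      = (2 * π) ^ (-(3 : ℝ) / 2) * (t ^ (-(3 : ℝ) / 2) * Real.exp (-(r ^ 2 / 2) / t)) := by
    intro t ht
    have ht' : 0 < t := ht
    rw [heatKernel3, ← hrdef, Real.mul_rpow h2π ht'.le, mul_assoc]
    congr 3
    field_simp
  rw [setIntegral_congr_fun measurableSet_Ioi hcongr, integral_const_mul,
    integral_rpow_neg_three_halves_mul_exp_neg_div hc]
  -- numerical identity `(2π)^{-3/2} · ((2/r²)^{1/2} · √π) = (2π r)⁻¹`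
  have hsq : (1 / (r ^ 2 / 2)) ^ ((1 : ℝ) / 2) = Real.sqrt 2 / r := by
    rw [← Real.sqrt_eq_rpow, show (1 / (r ^ 2 / 2) : ℝ) = 2 / r ^ 2 by field_simp,
      Real.sqrt_div' _ (by positivity), Real.sqrt_sq hr.le]
  have h32 : (2 * π) ^ (-(3 : ℝ) / 2) = ((2 * π) * Real.sqrt (2 * π))⁻¹ := by
    rw [show (-(3 : ℝ) / 2) = -((1 : ℝ) + 1 / 2) by norm_num, Real.rpow_neg h2π,
      Real.rpow_add (by positivity : (0 : ℝ) < 2 * π), Real.rpow_one, ← Real.sqrt_eq_rpow]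
  have hsqrt2π : Real.sqrt (2 * π) = Real.sqrt 2 * Real.sqrt π :=
    Real.sqrt_mul (by norm_num) π
  have hs2 : 0 < Real.sqrt 2 := Real.sqrt_pos.2 (by norm_num)
  have hsπ : 0 < Real.sqrt π := Real.sqrt_pos.2 Real.pi_pos
  rw [hsq, h32, hsqrt2π]
  field_simp

/-- **The lifetime density integrates to one**: `∫₀^∞ 2π‖x − y‖ · p_t(x, y) dt = 1` for `x ≠ y`
(the law of the hitting time of `y` by Brownian motion from `x` conditioned to hit `y`).
[cite: PortStone1978, Ch. 3] -/
theorem integral_hittingDensity {x y : E3} (h : x ≠ y) :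
    ∫ t in Ioi (0 : ℝ), hittingDensity x y t = 1 := by
  have hr : 0 < ‖x - y‖ := norm_pos_iff.2 (sub_ne_zero.2 h)
  simp only [hittingDensity]
  rw [integral_const_mul, integral_heatKernel3 h]
  field_simp

/-- The lifetime density is integrable on `(0, ∞)` for `x ≠ y`. [folklore] -/
theorem integrableOn_hittingDensity {x y : E3} (h : x ≠ y) :
    IntegrableOn (hittingDensity x y) (Ioi (0 : ℝ)) :=
  integrable_of_integral_eq_one (integral_hittingDensity h)

/-- The total mass of the lifetime law is `1` for `x ≠ y`. [folklore] -/
theorem hittingTimeLaw_univ {x y : E3} (h : x ≠ y) : hittingTimeLaw x y univ = 1 := by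
  rw [hittingTimeLaw, withDensity_apply _ MeasurableSet.univ, Measure.restrict_univ,
    ← ofReal_integral_eq_lintegral_ofReal (integrableOn_hittingDensity h)
      ((ae_restrict_iff' measurableSet_Ioi).2 (Filter.Eventually.of_forall fun t ht =>
        hittingDensity_nonneg (le_of_lt ht) x y)),
    integral_hittingDensity h, ENNReal.ofReal_one]

/-- **The lifetime law `hittingTimeLaw x y` is a probability measure** for `x ≠ y` (the Green
identity). [cite: PortStone1978, Ch. 3] -/
theorem isProbabilityMeasure_hittingTimeLaw {x y : E3} (h : x ≠ y) :
    IsProbabilityMeasure (hittingTimeLaw x y) :=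
  ⟨hittingTimeLaw_univ h⟩

/-- The degenerate case: for `x = y` the lifetime density vanishes, so `hittingTimeLaw x x = 0`
(consistent with the junk value `brownianBridgeToPointRangeLaw3 x x = 0`). [folklore] -/
@[simp] theorem hittingTimeLaw_self (x : E3) : hittingTimeLaw x x = 0 := by
  have h0 : (fun t : ℝ => ENNReal.ofReal (hittingDensity x x t)) = 0 := by
    funext t
    simp [hittingDensity]
  rw [hittingTimeLaw, h0, withDensity_zero]


/-! ### Kelvin covariance of the heat kernel and of the lifetime law under the unit inversion

For the unit inversion `ι = EuclideanGeometry.inversion 0 1` (`ι z = z/‖z‖²`) and `x, y ≠ 0`: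
`‖ιx − ιy‖ = ‖x − y‖/(‖x‖‖y‖)`, hence `p_u(ιx, ιy) = (‖x‖‖y‖)³ · p_{(‖x‖‖y‖)² u}(x, y)` and the
lifetime law from `ιx` to `ιy` is the image of the lifetime law from `x` to `y` under the
deterministic time scaling `t ↦ t/(‖x‖‖y‖)²` — the `n = 0` shadow of the Kelvin covariance of the
bridge-to-a-point (`KelvinBridgeCovariance`). -/

namespace BrownianBridgeToPoint3

open EuclideanGeometry

/-- Distances under the unit inversion: `‖ιx − ιy‖ = ‖x − y‖ / (‖x‖‖y‖)` for `x, y ≠ 0`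
(`EuclideanGeometry.dist_inversion_inversion`). [folklore] -/
theorem norm_inversion_sub_inversion {x y : E3} (hx : x ≠ 0) (hy : y ≠ 0) :
    ‖inversion (0 : E3) 1 x - inversion (0 : E3) 1 y‖ = ‖x - y‖ / (‖x‖ * ‖y‖) := by
  have h := dist_inversion_inversion (c := (0 : E3)) hx hy (1 : ℝ)
  rw [dist_eq_norm, dist_eq_norm, dist_eq_norm, dist_eq_norm, sub_zero, sub_zero, one_pow] at h
  rw [h, div_mul_eq_mul_div, one_mul]

/-- Dilation change of variables for the lower Lebesgue integral on `ℝ`: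
`∫ G = a · ∫ G(a·s) ds` for `a > 0`. [folklore] -/
theorem lintegral_eq_ofReal_mul_lintegral_comp_mul_left (G : ℝ → ℝ≥0∞) {a : ℝ} (ha : 0 < a) :
    ∫⁻ t, G t = ENNReal.ofReal a * ∫⁻ s, G (a * s) := by
  have h1 : ∫⁻ s, G (a * s) = ∫⁻ t, G t ∂(Measure.map (fun s ↦ a * s) volume) := by
    rw [show (fun s ↦ a * s) = ⇑(Homeomorph.mulLeft₀ a ha.ne').toMeasurableEquiv from rfl,
      lintegral_map_equiv]
    rfl
  rw [h1, Real.map_volume_mul_left ha.ne', lintegral_smul_measure, smul_eq_mul,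
    abs_of_pos (inv_pos.2 ha), ← mul_assoc, ← ENNReal.ofReal_mul ha.le,
    mul_inv_cancel₀ ha.ne', ENNReal.ofReal_one, one_mul]

/-- **Kelvin transform of the heat kernel**: `p_u(ιx, ιy) = (‖x‖‖y‖)³ · p_{(‖x‖‖y‖)² u}(x, y)` for
`x, y ≠ 0`, `u > 0`. [folklore] -/
theorem heatKernel3_inversion {x y : E3} (hx : x ≠ 0) (hy : y ≠ 0) {u : ℝ} (hu : 0 < u) :
    heatKernel3 u (inversion (0 : E3) 1 x) (inversion (0 : E3) 1 y)
      = (‖x‖ * ‖y‖) ^ 3 * heatKernel3 ((‖x‖ * ‖y‖) ^ 2 * u) x y := by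
  have hxy : 0 < ‖x‖ * ‖y‖ := mul_pos (norm_pos_iff.2 hx) (norm_pos_iff.2 hy)
  set a : ℝ := ‖x‖ * ‖y‖ with ha
  have ha0 : a ≠ 0 := hxy.ne'
  have hu0 : u ≠ 0 := hu.ne'
  simp only [heatKernel3, norm_inversion_sub_inversion hx hy, ← ha]
  have h1 : (2 * π * (a ^ 2 * u)) ^ (-(3 : ℝ) / 2)
      = (a ^ 2) ^ (-(3 : ℝ) / 2) * (2 * π * u) ^ (-(3 : ℝ) / 2) := by
    rw [show 2 * π * (a ^ 2 * u) = a ^ 2 * (2 * π * u) by ring]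
    exact Real.mul_rpow (by positivity) (by positivity)
  have h2 : (a ^ 2) ^ (-(3 : ℝ) / 2) = (a ^ 3)⁻¹ := by
    rw [← Real.rpow_two, ← Real.rpow_mul hxy.le,
      show (2 : ℝ) * (-(3 : ℝ) / 2) = -(3 : ℝ) by norm_num, Real.rpow_neg hxy.le,
      show (3 : ℝ) = ((3 : ℕ) : ℝ) by norm_num, Real.rpow_natCast]
  have h3 : -(‖x - y‖ / a) ^ 2 / (2 * u) = -‖x - y‖ ^ 2 / (2 * (a ^ 2 * u)) := by
    rw [div_pow]
    field_simp
  rw [h1, h2, h3]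
  field_simp

/-- **Kelvin covariance of the Green (Newton) kernel**: `G(ιx, ιy) = ‖x‖‖y‖ · G(x, y)` with
`G(x, y) = ∫₀^∞ p_t(x, y) dt = (2π‖x − y‖)⁻¹`, for `x ≠ y` both nonzero — the two-point (`Δ = 1/2`)
instance of Möbius covariance. [folklore] -/
theorem integral_heatKernel3_inversion {x y : E3} (hx : x ≠ 0) (hy : y ≠ 0) (h : x ≠ y) :
    ∫ t in Ioi (0 : ℝ), heatKernel3 t (inversion (0 : E3) 1 x) (inversion (0 : E3) 1 y)
      = ‖x‖ * ‖y‖ * ∫ t in Ioi (0 : ℝ), heatKernel3 t x y := by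
  have hι : inversion (0 : E3) 1 x ≠ inversion (0 : E3) 1 y := fun hxy =>
    h ((inversion_involutive (0 : E3) one_ne_zero).injective hxy)
  have hx' : 0 < ‖x‖ := norm_pos_iff.2 hx
  have hy' : 0 < ‖y‖ := norm_pos_iff.2 hy
  have hxy : 0 < ‖x - y‖ := norm_pos_iff.2 (sub_ne_zero.2 h)
  rw [integral_heatKernel3 hι, integral_heatKernel3 h, norm_inversion_sub_inversion hx hy]
  field_simp

/-- **Kelvin covariance of the lifetime density**:
`hittingDensity (ιx) (ιy) u = (‖x‖‖y‖)² · hittingDensity x y ((‖x‖‖y‖)² u)` for `x, y ≠ 0`, `u > 0`.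
[folklore] -/
theorem hittingDensity_inversion {x y : E3} (hx : x ≠ 0) (hy : y ≠ 0) {u : ℝ} (hu : 0 < u) :
    hittingDensity (inversion (0 : E3) 1 x) (inversion (0 : E3) 1 y) u
      = (‖x‖ * ‖y‖) ^ 2 * hittingDensity x y ((‖x‖ * ‖y‖) ^ 2 * u) := by
  have hx' : 0 < ‖x‖ := norm_pos_iff.2 hx
  have hy' : 0 < ‖y‖ := norm_pos_iff.2 hy
  simp only [hittingDensity]
  rw [heatKernel3_inversion hx hy hu, norm_inversion_sub_inversion hx hy]
  field_simp

/-- **Kelvin covariance of the lifetime law** (the `n = 0` shadow of `KelvinBridgeCovariance`):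
for `x, y ≠ 0` the lifetime law of the bridge-to-a-point from `ιx` to `ιy` is the image of the
lifetime law from `x` to `y` under the time scaling `t ↦ t / (‖x‖‖y‖)²`. [folklore] -/
theorem hittingTimeLaw_inversion {x y : E3} (hx : x ≠ 0) (hy : y ≠ 0) :
    hittingTimeLaw (inversion (0 : E3) 1 x) (inversion (0 : E3) 1 y)
      = (hittingTimeLaw x y).map (fun t : ℝ => t / (‖x‖ * ‖y‖) ^ 2) := by
  have hxy : 0 < ‖x‖ * ‖y‖ := mul_pos (norm_pos_iff.2 hx) (norm_pos_iff.2 hy)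
  set a : ℝ := ‖x‖ * ‖y‖ with ha
  have ha2 : 0 < a ^ 2 := by positivity
  have hmeas : Measurable fun t : ℝ => t / a ^ 2 := measurable_id.div_const _
  ext s hs
  rw [Measure.map_apply hmeas hs, hittingTimeLaw, hittingTimeLaw, withDensity_apply _ hs,
    withDensity_apply _ (hmeas hs), Measure.restrict_restrict hs,
    Measure.restrict_restrict (hmeas hs), ← lintegral_indicator (hs.inter measurableSet_Ioi),
    ← lintegral_indicator ((hmeas hs).inter measurableSet_Ioi),
    lintegral_eq_ofReal_mul_lintegral_comp_mul_left
      (((fun t : ℝ => t / a ^ 2) ⁻¹' s ∩ Ioi 0).indicator fun t => ENNReal.ofReal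
        (hittingDensity x y t)) ha2,
    ← lintegral_const_mul' _ _ ENNReal.ofReal_ne_top]
  congr 1
  funext u
  -- pointwise identity of the two integrands
  have hpre : (a ^ 2 * u ∈ (fun t : ℝ => t / a ^ 2) ⁻¹' s ∩ Ioi 0) ↔ u ∈ s ∩ Ioi 0 := by
    simp only [mem_inter_iff, mem_preimage, mem_Ioi, mul_div_cancel_left₀ u ha2.ne']
    exact and_congr Iff.rfl (mul_pos_iff_of_pos_left ha2)
  by_cases hu : u ∈ s ∩ Ioi 0
  · rw [indicator_of_mem hu, indicator_of_mem (hpre.2 hu),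
      hittingDensity_inversion hx hy (show 0 < u from hu.2), ← ha,
      ENNReal.ofReal_mul ha2.le]
  · rw [indicator_of_notMem hu, indicator_of_notMem (fun h => hu (hpre.1 h)), mul_zero]

end BrownianBridgeToPoint3

end Literature.Probability.Process
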